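import Mathlib
import Summits.SmoothPoincare4.SmoothPoincare4.Theorems.SullivanDualTameOrBrodyR4StubSmoothLimit

/-!
# Local smooth limits under locally uniform derivative bounds

Helper file of the lead (c2) for line `Sketch` of the crux `WitnessCharge`
(stmt-SmoothPoincare4-7824, route SullivanDual), registered stub `helper_smoothLimitLocal`.

Local form, on an open set `U ⊆ ℂ`, of the landed global lemma `stub_smoothLimit`
(`SullivanDualTameOrBrodyR4StubSmoothLimit`): if maps `u n : ℂ → ℝ⁴` are `C^∞` on `U`, all their
derivatives are bounded on every compact subset of `U` uniformly in `n`, and `u n → v` locally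
uniformly on `U`, then `v` is `C^∞` on `U` and `d(u n) → dv` locally uniformly on `U`.

Proof by cut-off: around `z₀ ∈ U` take a smooth bump `χ : ContDiffBump z₀` with
`tsupport χ = closedBall z₀ χ.rOut ⊆ U`. The maps `χ • u n`, `χ • v` are `C^∞` on all of `ℂ`
(products of smooth maps near points of `U`, locally zero off `tsupport χ`), the derivatives of
`χ • u n` are bounded on `ℂ` uniformly in `n` (Leibniz bound `norm_iteratedFDerivWithin_smul_le`
on `tsupport χ`, zero outside), and `χ • u n → χ • v` locally uniformly on `ℂ` (`0 ≤ χ ≤ 1`).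
Hence `stub_smoothLimit` applies to the cut-offs, and on `ball z₀ χ.rIn`, where `χ ≡ 1` near
every point, its two conclusions transfer back to `u n` and `v`.
-/

noncomputable section

-- the registered namespace `Summit.SmoothPoincare4.SmoothPoincare4.…` repeats a component
set_option linter.dupNamespace false

open scoped ContDiff Topology Nat
open Filter Set Metric
open Summit.SmoothPoincare4.SmoothPoincare4.Cruxes.TameOrBrodyR4.Sketch

namespace Summit.SmoothPoincare4.SmoothPoincare4.Theorems.WitnessCharge.PencilIncompleteness

namespace SmoothLimitLocal

variable {F : Type*} [NormedAddCommGroup F] [NormedSpace ℝ F]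

/-- Off the topological support of the bump `χ`, every cut-off `χ • w` vanishes near the point. -/
theorem cutoff_eventuallyEq_zero {z₀ z : ℂ} (χ : ContDiffBump z₀) (hz : z ∉ tsupport χ)
    (w : ℂ → F) : (fun y => χ y • w y) =ᶠ[𝓝 z] fun _ => 0 := by
  filter_upwards [notMem_tsupport_iff_eventuallyEq.mp hz] with y hy
  simp [hy]

/-- On the inner ball of the bump `χ`, every cut-off `χ • w` agrees with `w` near the point. -/
theorem cutoff_eventuallyEq {z₀ z : ℂ} (χ : ContDiffBump z₀) (hz : z ∈ ball z₀ χ.rIn)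
    (w : ℂ → F) : (fun y => χ y • w y) =ᶠ[𝓝 z] w := by
  filter_upwards [χ.eventuallyEq_one_of_mem_ball hz] with y hy
  simp [hy]

/-- The cut-off by `χ` of a map that is `C^∞` on an open set `U ⊇ tsupport χ` is `C^∞` on `ℂ`. -/
theorem cutoff_contDiff {U : Set ℂ} (hU : IsOpen U) {z₀ : ℂ} (χ : ContDiffBump z₀)
    (hχU : tsupport χ ⊆ U) {w : ℂ → F} (hw : ContDiffOn ℝ ∞ w U) :
    ContDiff ℝ ∞ fun y => χ y • w y :=
  contDiff_iff_contDiffAt.2 fun z => by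
    by_cases hz : z ∈ U
    · exact χ.contDiffAt.smul (hw.contDiffAt (hU.mem_nhds hz))
    · exact contDiffAt_const.congr_of_eventuallyEq
        (cutoff_eventuallyEq_zero χ (fun h => hz (hχU h)) w)

/-- The derivatives of every order of the cut-offs `χ • u n` are bounded on `ℂ`, uniformly in `n`,
as soon as those of `u n` are bounded on the compact set `tsupport χ ⊆ U` uniformly in `n`. -/
theorem cutoff_bound {U : Set ℂ} (hU : IsOpen U) {u : ℕ → ℂ → F}
    (hu : ∀ n, ContDiffOn ℝ ∞ (u n) U)
    (hb : ∀ (k : ℕ) (K : Set ℂ), IsCompact K → K ⊆ U →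
      ∃ C : ℝ, ∀ n, ∀ z ∈ K, ‖iteratedFDeriv ℝ k (u n) z‖ ≤ C)
    {z₀ : ℂ} (χ : ContDiffBump z₀) (hχU : tsupport χ ⊆ U) (k : ℕ) :
    ∃ C : ℝ, ∀ n z, ‖iteratedFDeriv ℝ k (fun y => χ y • u n y) z‖ ≤ C := by
  have hK : IsCompact (tsupport χ) := χ.hasCompactSupport
  -- bounds for the derivatives of `χ` and of the `u n` on `tsupport χ`
  have hA : ∀ i : ℕ, ∃ A : ℝ, ∀ z ∈ tsupport χ, ‖iteratedFDeriv ℝ i χ z‖ ≤ A := fun i =>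
    hK.exists_bound_of_continuousOn
      ((χ.contDiff (n := i)).continuous_iteratedFDeriv (mod_cast le_rfl)).continuousOn
  choose A hA using hA
  have hB : ∀ j : ℕ, ∃ B : ℝ, ∀ n, ∀ z ∈ tsupport χ, ‖iteratedFDeriv ℝ j (u n) z‖ ≤ B :=
    fun j => hb j _ hK hχU
  choose B hB using hB
  have hz₀ : z₀ ∈ tsupport χ := by
    rw [χ.tsupport_eq]
    exact mem_closedBall_self χ.rOut_pos.le
  have hA0 : ∀ i, 0 ≤ A i := fun i => (norm_nonneg _).trans (hA i z₀ hz₀)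
  have hB0 : ∀ j, 0 ≤ B j := fun j => (norm_nonneg _).trans (hB j 0 z₀ hz₀)
  refine ⟨∑ i ∈ Finset.range (k + 1), (k.choose i : ℝ) * A i * B (k - i), fun n z => ?_⟩
  by_cases hz : z ∈ tsupport χ
  · -- Leibniz bound on the open set `U ∋ z`
    have hzU : z ∈ U := hχU hz
    rw [← iteratedFDerivWithin_of_isOpen k hU hzU]
    calc ‖iteratedFDerivWithin ℝ k (fun y => χ y • u n y) U z‖
        ≤ ∑ i ∈ Finset.range (k + 1), (k.choose i : ℝ) * ‖iteratedFDerivWithin ℝ i χ U z‖ *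
            ‖iteratedFDerivWithin ℝ (k - i) (u n) U z‖ :=
          norm_iteratedFDerivWithin_smul_le χ.contDiff.contDiffOn (hu n) hU.uniqueDiffOn hzU
            (mod_cast le_top)
      _ ≤ ∑ i ∈ Finset.range (k + 1), (k.choose i : ℝ) * A i * B (k - i) := by
          refine Finset.sum_le_sum fun i _ => ?_
          rw [iteratedFDerivWithin_of_isOpen i hU hzU,
            iteratedFDerivWithin_of_isOpen (k - i) hU hzU]
          exact mul_le_mul (mul_le_mul_of_nonneg_left (hA i z hz) (Nat.cast_nonneg _))
            (hB (k - i) n z hz) (norm_nonneg _) (mul_nonneg (Nat.cast_nonneg _) (hA0 i))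
  · -- off `tsupport χ` the cut-off vanishes near `z`
    rw [((cutoff_eventuallyEq_zero χ hz (u n)).iteratedFDeriv ℝ k).eq_of_nhds,
      iteratedFDeriv_fun_zero, Pi.zero_apply, norm_zero]
    exact Finset.sum_nonneg fun i _ =>
      mul_nonneg (mul_nonneg (Nat.cast_nonneg _) (hA0 i)) (hB0 _)

/-- The cut-offs `χ • u n` converge to `χ • v` locally uniformly on `ℂ` as soon as `u n → v`
locally uniformly on an open set `U ⊇ tsupport χ`. -/
theorem cutoff_tendsto {U : Set ℂ} (hU : IsOpen U) {u : ℕ → ℂ → F} {v : ℂ → F}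
    (hlim : TendstoLocallyUniformlyOn u v atTop U) {z₀ : ℂ} (χ : ContDiffBump z₀)
    (hχU : tsupport χ ⊆ U) :
    TendstoLocallyUniformly (fun n y => χ y • u n y) (fun y => χ y • v y) atTop := by
  rw [Metric.tendstoLocallyUniformly_iff]
  intro ε hε x
  by_cases hx : x ∈ U
  · obtain ⟨t, ht, hev⟩ := Metric.tendstoLocallyUniformlyOn_iff.mp hlim ε hε x hx
    rw [hU.nhdsWithin_eq hx] at ht
    refine ⟨t, ht, hev.mono fun n hn y hy => ?_⟩
    calc dist (χ y • v y) (χ y • u n y) = χ y * dist (v y) (u n y) := by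
          rw [dist_smul₀, Real.norm_of_nonneg χ.nonneg]
      _ ≤ 1 * dist (v y) (u n y) := by gcongr; exact χ.le_one
      _ < ε := by rw [one_mul]; exact hn y hy
  · refine ⟨(tsupport χ)ᶜ, (isClosed_tsupport χ).isOpen_compl.mem_nhds fun h => hx (hχU h),
      Eventually.of_forall fun n y hy => ?_⟩
    rw [image_eq_zero_of_notMem_tsupport hy, zero_smul, zero_smul, dist_self]
    exact hε

/-- The local conclusion on the inner ball of a bump `χ` with `tsupport χ ⊆ U`: `v` is `C^∞` on
`ball z₀ χ.rIn` and `d(u n) → dv` locally uniformly there (`stub_smoothLimit` for the cut-offs,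
transferred back through `χ ≡ 1` near each point of the ball). -/
theorem smoothLimit_ball {U : Set ℂ} (hU : IsOpen U) {u : ℕ → ℂ → EuclideanSpace ℝ (Fin 4)}
    {v : ℂ → EuclideanSpace ℝ (Fin 4)} (hu : ∀ n, ContDiffOn ℝ ∞ (u n) U)
    (hb : ∀ (k : ℕ) (K : Set ℂ), IsCompact K → K ⊆ U →
      ∃ C : ℝ, ∀ n, ∀ z ∈ K, ‖iteratedFDeriv ℝ k (u n) z‖ ≤ C)
    (hlim : TendstoLocallyUniformlyOn u v atTop U) {z₀ : ℂ} (χ : ContDiffBump z₀)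
    (hχU : tsupport χ ⊆ U) :
    ContDiffOn ℝ ∞ v (ball z₀ χ.rIn) ∧
      TendstoLocallyUniformlyOn (fun n => fderiv ℝ (u n)) (fderiv ℝ v) atTop (ball z₀ χ.rIn) := by
  obtain ⟨hv, hder⟩ := stub_smoothLimit (fun n y => χ y • u n y) (fun y => χ y • v y)
    (fun n => cutoff_contDiff hU χ hχU (hu n))
    (fun k _ => (cutoff_bound hU hu hb χ hχU k).imp fun C hC n z _ => hC n z)
    (cutoff_tendsto hU hlim χ hχU)
  refine ⟨fun z hz => ?_, ?_⟩
  · exact (hv.contDiffAt.congr_of_eventuallyEq (cutoff_eventuallyEq χ hz v).symm).contDiffWithinAt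
  · refine ((hder.tendstoLocallyUniformlyOn (s := ball z₀ χ.rIn)).congr
      fun n z hz => ?_).congr_right fun z hz => ?_
    · exact (cutoff_eventuallyEq χ hz (u n)).fderiv_eq
    · exact (cutoff_eventuallyEq χ hz v).fderiv_eq

end SmoothLimitLocal

/-- **Local smooth limits (stub A3 of line `Sketch`).** On an open `U ⊆ ℂ`: maps `C^∞` on `U`
with all derivatives bounded uniformly in `n` on every compact subset of `U`, converging locally
uniformly on `U`, have a limit that is `C^∞` on `U`, and the first derivatives converge locally
uniformly on `U` (local form of the landed `stub_smoothLimit`, by cut-off). -/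
theorem helper_smoothLimitLocal :
    ∀ (U : Set ℂ), IsOpen U → ∀ (u : ℕ → ℂ → EuclideanSpace ℝ (Fin 4))
      (v : ℂ → EuclideanSpace ℝ (Fin 4)), (∀ n, ContDiffOn ℝ ∞ (u n) U) →
      (∀ (k : ℕ) (K : Set ℂ), IsCompact K → K ⊆ U →
        ∃ C : ℝ, ∀ n, ∀ z ∈ K, ‖iteratedFDeriv ℝ k (u n) z‖ ≤ C) →
      TendstoLocallyUniformlyOn u v atTop U →
      ContDiffOn ℝ ∞ v U ∧
        TendstoLocallyUniformlyOn (fun n => fderiv ℝ (u n)) (fderiv ℝ v) atTop U := by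
  intro U hU u v hu hb hlim
  -- a smooth bump around each point of `U`, supported in `U`
  have hχ : ∀ z₀ ∈ U, ∃ χ : ContDiffBump z₀, tsupport χ ⊆ U := fun z₀ hz₀ => by
    obtain ⟨R, hR, hRU⟩ := Metric.isOpen_iff.mp hU z₀ hz₀
    refine ⟨⟨R / 4, R / 2, by linarith, by linarith⟩, ?_⟩
    rw [ContDiffBump.tsupport_eq]
    exact (closedBall_subset_ball (show R / 2 < R by linarith)).trans hRU
  refine ⟨fun z₀ hz₀ => ?_, fun e he z₀ hz₀ => ?_⟩
  · obtain ⟨χ, hχU⟩ := hχ z₀ hz₀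
    exact ((SmoothLimitLocal.smoothLimit_ball hU hu hb hlim χ hχU).1.contDiffAt
      (ball_mem_nhds z₀ χ.rIn_pos)).contDiffWithinAt
  · obtain ⟨χ, hχU⟩ := hχ z₀ hz₀
    obtain ⟨t, ht, hev⟩ :=
      (SmoothLimitLocal.smoothLimit_ball hU hu hb hlim χ hχU).2 e he z₀ (mem_ball_self χ.rIn_pos)
    rw [isOpen_ball.nhdsWithin_eq (mem_ball_self χ.rIn_pos)] at ht
    exact ⟨t, mem_nhdsWithin_of_mem_nhds ht, hev⟩

end Summit.SmoothPoincare4.SmoothPoincare4.Theorems.WitnessCharge.PencilIncompleteness
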